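import Literature.Probability.RandomPlanarGeometry.RestrictionMapProofs
import Literature.Probability.RandomPlanarGeometry.ArcApproximation
import Literature.Probability.RandomPlanarGeometry.HullApproximationProofs
import Literature.Probability.RandomPlanarGeometry.ArcHullDomains
import Literature.Probability.RandomPlanarGeometry.HullSubdomainPullback
import Literature.Probability.RandomPlanarGeometry.RestrictionSides
import Literature.Probability.RandomPlanarGeometry.ConformalMapCaratheodoryProofs
import Literature.Probability.RandomPlanarGeometry.ConformalMapRiemannProofs
import Literature.Probability.RandomPlanarGeometry.JordanDomainProofs
import Literature.Topology.PlaneTopology.JordanCurveProofs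
import Summits.CriticalPhenomena.SAWScalingLimit.Theorems.SAWLoopFugacityFlowAvoidanceDeterminesLawConn
import Summits.CriticalPhenomena.SAWScalingLimit.Theorems.SAWLoopFugacityFlowAvoidanceDeterminesLawHulls
import Summits.CriticalPhenomena.SAWScalingLimit.Theorems.SAWLoopFugacityFlowAvoidanceDeterminesLawStar

/-!
# Avoidance determines the law (stmt-CriticalPhenomena-1373): hull subdomains squeezing a `*`-hull

Landing target:
`Summits/CriticalPhenomena/SAWScalingLimit/Theorems/SAWLoopFugacityFlowAvoidanceDeterminesLawBumps.lean`
(`--supports stmt-CriticalPhenomena-1373`).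

The geometric core of the proof of `AvoidanceDeterminesLaw`. For a chordal uniformizing map
`φ : (ℍ; 0, ∞) → (D; a, b)`, a `*`-hull `A` avoided by some configuration `K` of [LSW]'s `Ω`,
constants `0 < c ≤ ‖z‖ ≤ R` on `A` and `ε > 0`, we construct a Jordan hull subdomain `D'` of
`D` (`MarkedDomain.IsHullSubdomain`) whose pull-back `φ⁻¹(D') ⊆ ℍ` is squeezed as follows:

* every point of `A ∩ ℍ` is off the closure of `φ⁻¹(D')` (so a chordal curve inside `cl D'`
  avoids `φ(A)`), and
* every point of `ℍ` at distance `≥ ε` from `A ∪ [-R, -c] ∪ [c, R]` lies in `φ⁻¹(D')` (so a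
  chordal curve whose pulled-back trace stays `ε`-away from that compact set lies in `cl D'`).

(`exists_isHullSubdomain_squeeze`.) The `−`-part `A₋` of `A` (`sidePart`, `HullDecomposition`) is
swallowed by a smooth `−`-hull `J₋` (reflected [LSW] Lemma 2.1), removed through
`exists_isHullSubdomain_of_isArcHull` (`ArcHullDomains`); the hull subdomain `D₁ = φ(ℍ ∖ J₋)` is
uniformized by `φ ∘ Φ_{J₋}⁻¹` (`IsChordalUniformizing.pullback`), where `Φ_{J₋}` is the restriction
map of the `−`-part `J₋` of the `*`-hull `C = A₊ ∪ J₋` (`isStarHull_union_of_sides`), whose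
symmetric extension `E` carries `A₊` to the `+`-hull `B = E(A₊)` (`IsStarHull.plusImage`,
`RestrictionMapProofs`); a smooth `+`-hull `J₊ ⊇ B` inside `E(W)` for a thin open `W` is then
removed from `D₁`. One-sided `A` need one step only.
-/

noncomputable section

open scoped Topology
open Filter Set Metric Bornology
open Literature.Probability.RandomPlanarGeometry
open UpperHalfPlane (upperHalfPlaneSet isOpen_upperHalfPlaneSet)

namespace Summit.CriticalPhenomena.SAWScalingLimit.Theorems.AvoidanceDeterminesLaw

/-! ### Pull-backs of hull subdomains obtained from smooth hulls -/

section Squeeze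

variable {D : DobrushinDomain} {φ : ConformalEquiv upperHalfPlaneSet D.carrier}

/-- **Removing a smooth `*`-hull.** For a chordal uniformizing map `φ` of `D` and a smooth
`*`-hull `J`, there is a hull subdomain `D₁` of `D` with carrier `φ(ℍ ∖ J)`, pulled-back hull
`J` and pulled-back domain `ℍ ∖ J` (Jordan curve theorem and Carathéodory,
`exists_isHullSubdomain_of_isArcHull`). [folklore] -/
theorem exists_isHullSubdomain_of_isArcHull' (hφ : D.IsChordalUniformizing φ) {J : Set ℂ}
    (hJ : IsArcHull J) (h0 : (0 : ℂ) ∉ J) :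
    ∃ D₁ : DobrushinDomain, D.IsHullSubdomain D₁ ∧
      D₁.carrier = φ '' (upperHalfPlaneSet \ J) ∧ φ.pullbackHull D₁ = J ∧
      φ.pullbackDomain D₁ = upperHalfPlaneSet \ J := by
  obtain ⟨D₁, hD₁, hcar⟩ := exists_isHullSubdomain_of_isArcHull
    Literature.Topology.PlaneTopology.JordanCurveTheorem_holds
    JordanDomain.exists_continuousOn_extension_holds hφ hJ h0
  have hpb : φ.pullbackHull D₁ = J := pullbackHull_eq_of_carrier_eq hJ.1 hcar
  refine ⟨D₁, hD₁, hcar, hpb, ?_⟩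
  rw [← ConformalEquiv.diff_pullbackHull, hpb]

/-- Points interior to `J` are off the closure of `ℍ ∖ J`. [folklore] -/
theorem notMem_closure_diff_of_mem_interior {J S : Set ℂ} {t : ℂ} (ht : t ∈ interior J)
    (hS : S ⊆ Jᶜ) (htS : t ∈ closure S) : False := by
  have : t ∈ closure Jᶜ := closure_mono hS htS
  rw [closure_compl] at this
  exact this ht

/-- **The one-sided squeeze.** If `A ∩ ℍ ⊆ interior J` and `J ⊆ {infDist · Q < ε}` for a smooth
`*`-hull `J`, the hull subdomain `D₁ = φ(ℍ ∖ J)` has its pull-back squeezed between `A` and the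
`ε`-neighbourhood of `Q`. [folklore] -/
theorem exists_isHullSubdomain_squeeze_of_isArcHull (hφ : D.IsChordalUniformizing φ) {A J Q : Set ℂ}
    (hJ : IsArcHull J) (h0 : (0 : ℂ) ∉ J) (hint : ∀ z ∈ A, 0 < z.im → z ∈ interior J) {ε : ℝ}
    (hJQ : J ⊆ {z : ℂ | infDist z Q < ε}) :
    ∃ D' : DobrushinDomain, D.IsHullSubdomain D' ∧
      Disjoint (A ∩ upperHalfPlaneSet) (closure (φ.pullbackDomain D')) ∧
      ∀ z ∈ upperHalfPlaneSet, ε ≤ infDist z Q → z ∈ φ.pullbackDomain D' := by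
  obtain ⟨D₁, hD₁, -, -, hpd⟩ := exists_isHullSubdomain_of_isArcHull' hφ hJ h0
  refine ⟨D₁, hD₁, ?_, fun z hz hzQ ↦ ?_⟩
  · rw [hpd]
    refine Set.disjoint_left.2 fun t ⟨htA, htH⟩ htcl ↦ ?_
    exact notMem_closure_diff_of_mem_interior (hint t htA htH) (fun w hw ↦ hw.2) htcl
  · rw [hpd]
    exact ⟨hz, fun hzJ ↦ (not_lt.2 hzQ) (hJQ hzJ)⟩

/-- **The two-sided squeeze.** For a `*`-hull `A` with both `±`-parts nonempty, avoided by a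
configuration `K`, with `0 < c ≤ ‖z‖ ≤ R` on `A`, and `ε > 0`: a hull subdomain `D'` of `D` with
`A ∩ ℍ` off `closure (φ⁻¹ D')` and every point of `ℍ` at distance `≥ ε` from
`A ∪ [-R, -c] ∪ [c, R]` inside `φ⁻¹ D'` (module docstring for the construction).
[cite: LawlerSchrammWerner2003Restriction, Lemma 2.1 (p. 8) and §2 p. 8 (A = A₁ · A₂), transposed] -/
theorem exists_isHullSubdomain_squeeze_two (hφ : D.IsChordalUniformizing φ) {A : Set ℂ}
    (hA : IsStarHull A) (K : RestrictionConfig) (hKA : Disjoint (K : Set ℂ) A) {c R : ℝ}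
    (hc : 0 < c) (hnorm : ∀ z ∈ A, c ≤ ‖z‖ ∧ ‖z‖ ≤ R)
    (hnePlus : (sidePart A 1).Nonempty) (hneMinus : (sidePart A (-1)).Nonempty) {ε : ℝ} (hε : 0 < ε) :
    ∃ D' : DobrushinDomain, D.IsHullSubdomain D' ∧
      Disjoint (A ∩ upperHalfPlaneSet) (closure (φ.pullbackDomain D')) ∧
      ∀ z ∈ upperHalfPlaneSet,
        ε ≤ infDist z (A ∪ (((↑) : ℝ → ℂ) '' Icc (-R) (-c) ∪ ((↑) : ℝ → ℂ) '' Icc c R)) →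
        z ∈ φ.pullbackDomain D' := by
  classical
  have hJCT := Literature.Topology.PlaneTopology.JordanCurveTheorem_holds
  have hC : JordanDomain.exists_continuousOn_extension := JordanDomain.exists_continuousOn_extension_holds
  have hsc : ∀ D : JordanDomain, D.isSimplyConnected := JordanDomain.isSimplyConnected_holds
  have hRM : ∀ {U : Set ℂ}, exists_conformalEquiv_ball (U := U) := fun {U} ↦ exists_conformalEquiv_ball_holds
  -- the `±`-parts
  set Q : Set ℂ := A ∪ (((↑) : ℝ → ℂ) '' Icc (-R) (-c) ∪ ((↑) : ℝ → ℂ) '' Icc c R) with hQdef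
  have hnf : IsConnected (A ∪ {z : ℂ | z.im ≤ 0}) := hA.isBoundedHull.isConnected_union_im_nonpos
  set X : Set ℂ := sidePart A 1 with hXdef
  set Am : Set ℂ := sidePart A (-1) with hAmdef
  have hX : IsPlusHull X := hA.isPlusHull_sidePart hnf
  have hAm : IsMinusHull Am := hA.isMinusHull_sidePart hnf
  have hunion : X ∪ Am = A := hA.plusPart_union_minusPart
  have hXA : X ⊆ A := sidePart_subset A 1
  have hAmA : Am ⊆ A := sidePart_subset A (-1)
  have hdisj : Disjoint X Am := by
    have := hA.disjoint_sidePart (s := 1)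
    rwa [show -(1 : ℝ) = -1 from rfl] at this
  have hXc : IsClosed X := hX.1.isBoundedHull.isClosed
  have hAc : IsClosed A := hA.isBoundedHull.isClosed
  have hKX : Disjoint (K : Set ℂ) X := hKA.mono_right hXA
  have hXright : X ⊆ K.rightDomain := K.subset_rightDomain_of_disjoint hX hKX
  have hcR : c ≤ R := by
    obtain ⟨a, ha⟩ := hnePlus
    have := hnorm a (hXA ha)
    exact this.1.trans this.2
  -- the open neighbourhood receiving `J₋`
  set U : Set ℂ := (X ∪ closure (K : Set ℂ))ᶜ ∩ {z : ℂ | infDist z Q < ε / 2} with hUdef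
  have hUo : IsOpen U := (hXc.union isClosed_closure).isOpen_compl.inter
    (isOpen_lt (continuous_infDist_pt Q) continuous_const)
  have hε2 : 0 < ε / 2 := by linarith
  have hAmU : Am ∪ ((↑) : ℝ → ℂ) '' Icc (-R) (-c) ⊆ U := by
    rintro z hz
    have hzQ : z ∈ Q := by
      rcases hz with hz | hz
      · exact Or.inl (hAmA hz)
      · exact Or.inr (Or.inl hz)
    refine ⟨fun hz' ↦ ?_, by
      show infDist z Q < ε / 2
      rw [infDist_zero_of_mem hzQ]; exact hε2⟩
    rcases hz' with hzX | hzK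
    · rcases hz with hz | ⟨x, hx, rfl⟩
      · exact Set.disjoint_left.1 hdisj hzX hz
      · have := hX.2 x hzX
        linarith [hx.2]
    · rw [K.closure_eq] at hzK
      rcases hzK with hzK | hz0
      · rcases hz with hz | ⟨x, hx, rfl⟩
        · exact Set.disjoint_left.1 hKA hzK (hAmA hz)
        · have : (0 : ℝ) < (x : ℂ).im := K.subset_upperHalfPlaneSet hzK
          simp at this
      · rw [mem_singleton_iff] at hz0
        subst hz0
        rcases hz with hz | ⟨x, hx, hx0⟩
        · exact hA.zero_notMem (hAmA hz)
        · have : x = 0 := by exact_mod_cast hx0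
          subst this
          linarith [hx.2]
  -- the smooth `−`-hull `J₋`
  obtain ⟨Jm, hJma, hJmm, hAmJm, hJmU, hintm⟩ := exists_isArcHull_subset_of_isMinusHull hAm hneMinus
    (fun z hz ↦ hnorm z (hAmA hz)) hUo hAmU
  have hJmb : IsBoundedHull Jm := hJma.1
  have hJmc : IsClosed Jm := hJmb.isClosed
  have hXJm : Disjoint X Jm := Set.disjoint_left.2 fun z hzX hzJ ↦ (hJmU hzJ).1 (Or.inl hzX)
  have hKJm : Disjoint (K : Set ℂ) Jm := Set.disjoint_left.2 fun z hzK hzJ ↦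
    (hJmU hzJ).1 (Or.inr (subset_closure hzK))
  have hJmleft : Jm ⊆ K.leftDomain := subset_leftDomain_of_isMinusHull hJmm K hKJm
  -- remove `J₋`
  obtain ⟨D₁, hD₁, -, hpb₁, hpd₁⟩ := exists_isHullSubdomain_of_isArcHull' hφ hJma hJmm.1.2
  -- the `*`-hull `C = X ∪ J₋`
  have hconn : IsConnected (upperHalfPlaneSet \ (X ∪ Jm)) :=
    isConnected_diff_union_of_sides K hXc hJmc hX.1.isBoundedHull.1 hJmb.1 hXright hJmleft
      (isConnected_diff_of_isBoundedHull hX.1.isBoundedHull) (isConnected_diff_of_isBoundedHull hJmb)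
  have hCstar : IsStarHull (X ∪ Jm) := isStarHull_union_of_sides hX hJmm hconn
  have hCplus : sidePart (X ∪ Jm) 1 = X := sidePart_union_one hX hJmm hXJm
  have hCminus : sidePart (X ∪ Jm) (-1) = Jm := sidePart_union_neg_one hX hJmm hXJm
  have hneCm : (sidePart (X ∪ Jm) (-1)).Nonempty := by rw [hCminus]; exact hneMinus.mono hAmJm
  have hneCp : (sidePart (X ∪ Jm) 1).Nonempty := by rw [hCplus]; exact hnePlus
  have hCm := hCstar.minusSlit hneCm
  have hneg := hCstar.slit_neg hneCm
  have hB : IsPlusHull (hCm.ext '' X) := by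
    have := hCstar.isPlusHull_plusImage hneCm
    rwa [IsStarHull.plusImage, hCplus] at this
  have hBne : (hCm.ext '' X).Nonempty := hnePlus.image _
  have hXΩ : X ⊆ slitDomain (sidePart (X ∪ Jm) (-1)) (IsStarHull.pMinus (X ∪ Jm))
      (IsStarHull.qMinus (X ∪ Jm)) := by
    have := hCstar.plusPart_subset_slitDomain hneCm
    rwa [hCplus] at this
  -- uniformize `D₁` by `φ ∘ Φ_{J₋}⁻¹`
  have hsets : upperHalfPlaneSet \ φ.pullbackHull D₁ = upperHalfPlaneSet \ sidePart (X ∪ Jm) (-1) := by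
    rw [hpb₁, hCminus]
  set Φ₁ : ConformalEquiv (upperHalfPlaneSet \ φ.pullbackHull D₁) upperHalfPlaneSet :=
    hCm.restrictionMap.copy _ _ hsets rfl with hΦ₁def
  have hΦ₁ : IsRestrictionMap (φ.pullbackHull D₁) Φ₁ :=
    hCm.isRestrictionMap.of_eq (by rw [hCminus, hpb₁])
  have hψ₁ := MarkedDomain.IsChordalUniformizing.pullback hsc hRM hC hφ hD₁ hΦ₁
  -- the thin open set `W` and the smooth `+`-hull `J₊ ⊆ E(W)`
  set W : Set ℂ := slitDomain (sidePart (X ∪ Jm) (-1)) (IsStarHull.pMinus (X ∪ Jm))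
      (IsStarHull.qMinus (X ∪ Jm)) ∩ {z : ℂ | infDist z Q < ε / 2} with hWdef
  have hWo : IsOpen W := hCm.isOpen_slitDomain.inter (isOpen_lt (continuous_infDist_pt Q) continuous_const)
  have hXW : X ⊆ W := fun z hz ↦ ⟨hXΩ hz, by
    show infDist z Q < ε / 2
    rw [infDist_zero_of_mem (show z ∈ Q from Or.inl (hXA hz))]; exact hε2⟩
  have hsegW : ((↑) : ℝ → ℂ) '' Icc c R ⊆ W := by
    rintro _ ⟨x, hx, rfl⟩
    refine ⟨hCm.ofReal_mem_slitDomain_of_pos hneg (hc.le.trans hx.1), ?_⟩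
    show infDist (x : ℂ) Q < ε / 2
    rw [infDist_zero_of_mem (show (x : ℂ) ∈ Q from Or.inr (Or.inr ⟨x, hx, rfl⟩))]
    exact hε2
  have hXreal : ∀ x : ℝ, (x : ℂ) ∈ X → c ≤ x ∧ x ≤ R := fun x hx ↦ by
    have h1 := hnorm _ (hXA hx)
    rw [Complex.norm_real, Real.norm_eq_abs, abs_of_pos (hX.2 x hx)] at h1
    exact h1
  obtain ⟨Jp, hJpa, hJpp, hBJp, hJpV, hintp⟩ := exists_isArcHull_image_subset hCm hneg hXΩ hB hBne
    hc hcR hXreal hWo inter_subset_left hXW hsegW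
  -- remove `J₊` from `D₁`
  obtain ⟨D₂, hD₂, hcar₂⟩ := exists_isHullSubdomain_of_isArcHull hJCT hC hψ₁ hJpa hJpp.1.2
  -- the pull-back of `D₂`
  have hΦ₁symm : ∀ w, Φ₁.symm w = hCm.restrictionMap.symm w := fun w ↦ rfl
  have hPD : ∀ z ∈ upperHalfPlaneSet, (z ∈ φ.pullbackDomain D₂ ↔ z ∉ Jm ∧ hCm.ext z ∉ Jp) := by
    intro z hzH
    constructor
    · intro hz
      have hz2 : φ z ∈ D₂.carrier := hz.2
      rw [hcar₂] at hz2
      obtain ⟨w, ⟨hwH, hwJ⟩, hw⟩ := hz2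
      rw [ConformalEquiv.trans_apply, ConformalEquiv.restrHull_apply, hΦ₁symm] at hw
      have hsm := hCm.symm_mem hwH
      have heq : hCm.restrictionMap.symm w = z := φ.injOn hsm.1 hzH hw
      refine ⟨?_, ?_⟩
      · have := hsm.2
        rwa [heq, hCminus] at this
      · have := hCm.ext_symm_apply hwH
        rw [heq] at this
        rwa [this]
    · rintro ⟨hzJm, hzJp⟩
      have hzd : z ∈ upperHalfPlaneSet \ sidePart (X ∪ Jm) (-1) := by
        rw [hCminus]; exact ⟨hzH, hzJm⟩
      have hwH : hCm.ext z ∈ upperHalfPlaneSet := hCm.mapsTo_ext hzd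
      refine ⟨hzH, ?_⟩
      show φ z ∈ D₂.carrier
      rw [hcar₂]
      refine ⟨hCm.ext z, ⟨hwH, hzJp⟩, ?_⟩
      rw [ConformalEquiv.trans_apply, ConformalEquiv.restrHull_apply, hΦ₁symm,
        ← hCm.restrictionMap_apply, hCm.restrictionMap.symm_apply_apply hzd]
  refine ⟨D₂, isHullSubdomain_trans hD₁ hD₂, ?_, fun z hzH hzQ ↦ ?_⟩
  · -- `A ∩ ℍ` is off the closure of `φ⁻¹ D₂`
    refine Set.disjoint_left.2 fun t ⟨htA, htH⟩ htcl ↦ ?_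
    rw [← hunion] at htA
    rcases htA with htX | htAm
    · have htd : t ∈ upperHalfPlaneSet \ sidePart (X ∪ Jm) (-1) := by
        rw [hCminus]; exact ⟨htH, fun h ↦ Set.disjoint_left.1 hXJm htX h⟩
      have hwH : hCm.ext t ∈ upperHalfPlaneSet := hCm.mapsTo_ext htd
      have hwint : hCm.ext t ∈ interior Jp := hintp _ (mem_image_of_mem _ htX) hwH
      have hcont : ContinuousAt hCm.ext t :=
        hCm.continuousOn_ext.continuousAt (hCm.isOpen_slitDomain.mem_nhds (hXΩ htX))
      have hcl : hCm.ext t ∈ closure (hCm.ext '' φ.pullbackDomain D₂) :=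
        hcont.continuousWithinAt.mem_closure_image htcl
      refine notMem_closure_diff_of_mem_interior hwint ?_ hcl
      rintro _ ⟨z, hz, rfl⟩
      exact ((hPD z hz.1).1 hz).2
    · refine notMem_closure_diff_of_mem_interior (hintm t htAm htH) (fun z hz ↦ ?_) htcl
      exact ((hPD z hz.1).1 hz).1
  · -- far points are inside
    have hzJm : z ∉ Jm := fun hzJm ↦ by
      have := (hJmU hzJm).2
      simp only [mem_setOf_eq] at this
      linarith
    refine (hPD z hzH).2 ⟨hzJm, fun hzJp ↦ ?_⟩
    · obtain ⟨z', hz'W, hzz'⟩ := hJpV hzJp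
      have hzd : z ∈ upperHalfPlaneSet \ sidePart (X ∪ Jm) (-1) := by
        rw [hCminus]; exact ⟨hzH, hzJm⟩
      have : z' = z := hCm.injOn_ext hz'W.1 (hCm.diff_subset_slitDomain hzd) hzz'
      subst this
      have := hz'W.2
      simp only [mem_setOf_eq] at this
      linarith

/-- **Hull subdomains squeezing a `*`-hull** (the statement consumed by the measure-theoretic
argument). For a chordal uniformizing map `φ` of `D`, a `*`-hull `A` avoided by some
configuration `K`, constants `0 < c ≤ ‖z‖ ≤ R` on `A`, and `ε > 0`, there is a hull subdomain
`D'` of `D` with `A ∩ ℍ` off `closure (φ⁻¹ D')` and every point of `ℍ` at distance `≥ ε` from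
`A ∪ [-R, -c] ∪ [c, R]` inside `φ⁻¹ D'`. Two-sided `A`: `exists_isHullSubdomain_squeeze_two`;
one-sided `A`: one smooth hull suffices; `A = ∅`: `D' = D`.
[cite: LawlerSchrammWerner2003Restriction, Lemma 2.1 (p. 8) and §2 p. 8 (A = A₁ · A₂), transposed] -/
theorem exists_isHullSubdomain_squeeze (hφ : D.IsChordalUniformizing φ) {A : Set ℂ}
    (hA : IsStarHull A) (K : RestrictionConfig) (hKA : Disjoint (K : Set ℂ) A) {c R : ℝ}
    (hc : 0 < c) (hnorm : ∀ z ∈ A, c ≤ ‖z‖ ∧ ‖z‖ ≤ R) {ε : ℝ} (hε : 0 < ε) :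
    ∃ D' : DobrushinDomain, D.IsHullSubdomain D' ∧
      Disjoint (A ∩ upperHalfPlaneSet) (closure (φ.pullbackDomain D')) ∧
      ∀ z ∈ upperHalfPlaneSet,
        ε ≤ infDist z (A ∪ (((↑) : ℝ → ℂ) '' Icc (-R) (-c) ∪ ((↑) : ℝ → ℂ) '' Icc c R)) →
        z ∈ φ.pullbackDomain D' := by
  classical
  set Q : Set ℂ := A ∪ (((↑) : ℝ → ℂ) '' Icc (-R) (-c) ∪ ((↑) : ℝ → ℂ) '' Icc c R) with hQdef
  have hnf : IsConnected (A ∪ {z : ℂ | z.im ≤ 0}) := hA.isBoundedHull.isConnected_union_im_nonpos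
  have hunion : sidePart A 1 ∪ sidePart A (-1) = A := hA.plusPart_union_minusPart
  set U : Set ℂ := {z : ℂ | infDist z Q < ε} with hUdef
  have hUo : IsOpen U := isOpen_lt (continuous_infDist_pt Q) continuous_const
  have hQU : Q ⊆ U := fun z hz ↦ by
    show infDist z Q < ε
    rw [infDist_zero_of_mem hz]; exact hε
  by_cases hneP : (sidePart A 1).Nonempty
  · by_cases hneM : (sidePart A (-1)).Nonempty
    · exact exists_isHullSubdomain_squeeze_two hφ hA K hKA hc hnorm hneP hneM hε
    · -- `A = A₊`
      rw [not_nonempty_iff_eq_empty] at hneM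
      rw [hneM, union_empty] at hunion
      have hX : IsPlusHull A := hunion ▸ hA.isPlusHull_sidePart hnf
      obtain ⟨J, hJa, hJp, -, hJU, hint⟩ := exists_isArcHull_subset_of_isPlusHull hX (hunion ▸ hneP) hnorm hUo
        (fun z hz ↦ hQU (hz.elim Or.inl fun h ↦ Or.inr (Or.inr h)))
      exact exists_isHullSubdomain_squeeze_of_isArcHull hφ hJa hJp.1.2 hint hJU
  · rw [not_nonempty_iff_eq_empty] at hneP
    rw [hneP, empty_union] at hunion
    by_cases hneM : (sidePart A (-1)).Nonempty
    · -- `A = A₋`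
      have hY : IsMinusHull A := hunion ▸ hA.isMinusHull_sidePart hnf
      obtain ⟨J, hJa, hJm, -, hJU, hint⟩ := exists_isArcHull_subset_of_isMinusHull hY (hunion ▸ hneM) hnorm hUo
        (fun z hz ↦ hQU (hz.elim Or.inl fun h ↦ Or.inr (Or.inl h)))
      exact exists_isHullSubdomain_squeeze_of_isArcHull hφ hJa hJm.1.2 hint hJU
    · -- `A = ∅`
      rw [not_nonempty_iff_eq_empty] at hneM
      have hA0 : A = ∅ := by rw [← hunion, hneM]
      refine ⟨D, MarkedDomain.isHullSubdomain_self D, ?_, fun z hz _ ↦ ⟨hz, φ.mapsTo hz⟩⟩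
      rw [hA0, empty_inter]
      exact empty_disjoint _

end Squeeze

end Summit.CriticalPhenomena.SAWScalingLimit.Theorems.AvoidanceDeterminesLaw

end
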